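import Summits.Ventures.QEC.Census.CertCheck
import HarnessLib

/-!
# Distance certificate DATA for the BB code `BB72` (CERT-FORMAT v1 → `DistCert`), emitted by qec-search-7

Source certificate: `cert/BB72.certA.json` — kernel A, id (sha256) `7e943c5a566adc431fafae9bee5044f0eb6f91382400148d543806dfe5c10f85`
(`certA=7e943c5a566adc43` on HOME/STATUS.md), method `bruteforce` both sides, `found` allow-lists of
sizes 0 (Z) / 0 (X). Code: n = 72, 36 X-checks, 36 Z-checks;
construction "BB" (l, m, A_terms, B_terms) = (6, 6, [[0, 1], [0, 2], [3, 0]], [[0, 3], [1, 0], [2, 0]]), CERT-FORMAT §index flattening (a,b) ↦ a·m+b, left block 0…lm−1, right block lm…2lm−1.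
Claimed result (by the certificate; established ONLY by the checker theorems in the sibling files):
n = 72, k = 12, dZ = 6, dX = 6, d = 6. Printed parameters [72, 12, 6] are a CLAIM of
Bravyi et al., Nature 627 (2024) 778-782 / arXiv:2308.07915, Table 3 (CLAIM; d by ILP in print) — never an input.

Conventions (= `Summits/Ventures/QEC/Census/CertCheck.lean`): a row / operator support is the binary numeral with bit `j` set iff
qubit `j` is in the support; side `Z` = Z-type operators (syndromes by `HX`, stabilizers `HZ`), side `X` the roles exchanged;
`found` = (word, indices of stabilizer rows XOR-ing to it). This file is DATA: no theorem, no `decide`. Generated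
2026-08-26T19:27Z by `HOME/census/search-7/emit_lean.py` (rerun recipe in its README); do not edit by hand — re-emit.
-/

namespace Summit.Ventures.QEC.Census.BB72

/-- The distance certificate of `BB72` as a `DistCert` literal (CERT-FORMAT v1 kernel fields; certificate id
`7e943c5a566adc43`): `n = 72`, `HX`/`HZ` = the 36 + 36 check rows as bitmasks, side Z = (d := 6, weight-6 Z-logical
witness, its non-membership witness, allow-list), side X likewise (d := 6). -/
def cert : DistCert where
  n := 72
  HX := [
    286422779297798, 572845558595596, 1145691117191192, 2287052907348016, 4574105814695969, 9148211629391875,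
    18331057875059072, 36662115750118144, 73324231500236288, 146371386070273024, 292742772140542016, 585485544281080000,
    1173187704003780608, 2346375408007561216, 4692750816015122432, 9367768708497473536, 18735537416994689024, 37471074833989120000,
    75084012987522482177, 150168025975044964354, 300336051950089928708, 599537196794082492424, 1199074393588148469776, 2398148787176280424480,
    83010348400513122368, 166020696801026244736, 332041393602052489472, 591448732413873619456, 1182897464826690274304, 2365794929652323584000,
    590295814831914094592, 1180591629663828189184, 2361183259327656378368, 73787012080505749504, 147574024093365764096, 295148048119085793280]
  HZ := [
    18017698134884360, 36031066942734352, 72057804558434336, 144115609116868609, 288231218233737218, 576462436467474436,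
    1153132611913122305, 2305988146896045058, 4611699216861890564, 9223398433723777096, 18446796867447554192, 36893593734895108384,
    73800487093720350785, 147583241263907930242, 295148749604283089156, 590297499208565920264, 1180594998417131840528, 2361189996834263681056,
    864691197176713280, 594475288256061568, 54043470414758144, 108086940813001216, 216173881626002432, 432347763252004864,
    55340236619309649920, 38046418448387940352, 3458782106544521216, 6917564212032077824, 13835128424064155648, 27670256848128311296,
    3541775143635817594880, 2434970780696828182528, 221362054818849357824, 442724109570052980736, 885448219140105961472, 1770896438280211922944]
  sideZ := { d := 6, witness := 1310771, nonmember := 226981507741506,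
             found := [] }
  sideX := { d := 6, witness := 9682550849, nonmember := 1310771,
             found := [] }

end Summit.Ventures.QEC.Census.BB72
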